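import Summits.BirchSwinnertonDyer.BirchSwinnertonDyer.Theorems.ClassRecordThreeEulerHalvesAtThreeCartanTorusCubeCutPSCentre
import Summits.BirchSwinnertonDyer.BirchSwinnertonDyer.Theorems.ClassRecordThreeEulerHalvesAtThreeCartanTorusCubeCutCuspChar
import Literature.NumberTheory.QuadraticForms.FiniteFieldHermitianCount
import HarnessLib

/-!
# Crux 23422 line `cartan` v8′, stub (F2a), PRINCIPAL-SERIES half of the torus-cube cut — file PS-2: the character `χ_W` is a
# class function; its values on triangular, diagonal and elliptic elements; the torus character sums in the principal-series
# case `q ≡ 1 (mod 3)` (`Σ_{D} χ_W = q − 1`, `Σ_{T_s} χ_W = (q − 1)²`, `Σ_{T_C} χ_W = (q − 1)(q + 1)`), hence `w_S ≠ 0`, `w_C ≠ 0`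

Seat `bsd-stepL-cartan-f2a` g0 (explicit unit, pen g44 AUTOFILL #2 row (3′); `--supports stmt-BirchSwinnertonDyer-23422 --as helper`).
* `charMat_conj` ∕ `char_conj`: `cubicNewvectorCharMat q (P M P⁻¹) = cubicNewvectorCharMat q M` — every atom of the definition
  (`tr`, `det`, `IsScalarMat`, `HasRatEigenvalue`, powers, `= 1`) is conjugation-invariant.
* values (`q ≡ 1 (mod 3)`, `k = (q−1)/3`): `charMat_diagonal` (`diag(a,c)`, `a ≠ c`: `2` if `a^k = c^k`, else `−1`), `charMat_upper`
  (`(a y; 0 c) ∼ diag(a,c)` for `a ≠ c`), `charMat_unipotent` (`(a y; 0 a)`, `y ≠ 0`: `1`), `charMat_elliptic` (no rational eigenvalue, `q` odd: `0`).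
* `card_cubeRoots`: `#{a ∈ 𝔽_q^× : a^k = 1} = k` (from `Literature…Hermitian.card_pow_eq_one`); `sum_char_mirabolic`: `Σ_a χ_W(diag(a,1)) = q − 1`;
  `sum_char_splitTorus`: `Σ_{T_s} χ_W = (q−1)²`; `sum_char_nonsplitTorus`: `Σ_{T_C} χ_W = (q−1)(q+1)` (scalars `q+1`, the rest elliptic by `not_hasRatEigenvalue_lin` of `…CuspChar`, p-tam3-p1 g21);
  hence (`wS_ne_zero`, `wC_ne_zero`) the generators `w_S`, `w_C` of the stubs (P1)–(P3) are non-zero.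
HONEST FRAMING: character bookkeeping for one explicit class function on `GL₂(𝔽_q)`; S-K1′ is NOT proved, no summit statement, no route item
and no registered stub is proved; BSD is proved for no curve. [folklore; background cite: Bump1997, §4.1]
-/

namespace Summit.BirchSwinnertonDyer.BirchSwinnertonDyer.Theorems.CartanTorusCubeCut.PS

open Summit.BirchSwinnertonDyer.BirchSwinnertonDyer.Theorems.CartanDegree
open Summit.BirchSwinnertonDyer.BirchSwinnertonDyer.Theorems.CartanTorusCubeCut

set_option linter.dupNamespace false
set_option autoImplicit false

/-! ### `χ_W` is a class function -/

section ClassFunction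
variable {q : ℕ}

/-- a scalar matrix is `c • 1`. -/
theorem isScalarMat_iff_eq_smul_one (M : Mat q) : IsScalarMat M ↔ ∃ c : ZMod q, M = c • (1 : Mat q) := by
  constructor
  · rintro ⟨h01, h10, h00⟩
    refine ⟨M 0 0, ?_⟩
    ext i j
    fin_cases i <;> fin_cases j <;> simp [h01, h10, h00]
  · rintro ⟨c, rfl⟩
    refine ⟨?_, ?_, ?_⟩ <;> simp

/-- scalar matrices are exactly the conjugation-invariant ones: `IsScalarMat (P M P⁻¹) ↔ IsScalarMat M`. -/
theorem isScalarMat_conj_iff (P : G q) (M : Mat q) :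
    IsScalarMat ((P : Mat q) * M * ((P⁻¹ : G q) : Mat q)) ↔ IsScalarMat M := by
  rw [isScalarMat_iff_eq_smul_one, isScalarMat_iff_eq_smul_one]
  constructor
  · rintro ⟨c, hc⟩
    refine ⟨c, ?_⟩
    calc M = ((P⁻¹ : G q) : Mat q) * ((P : Mat q) * M * ((P⁻¹ : G q) : Mat q)) * (P : Mat q) := by
          rw [← mul_assoc, ← mul_assoc, ← Units.val_mul, inv_mul_cancel, Units.val_one, one_mul, mul_assoc,
            ← Units.val_mul, inv_mul_cancel, Units.val_one, mul_one]
      _ = c • (1 : Mat q) := by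
          rw [hc, Matrix.mul_smul, Matrix.smul_mul, mul_one, ← Units.val_mul, inv_mul_cancel, Units.val_one]
  · rintro ⟨c, rfl⟩
    refine ⟨c, ?_⟩
    rw [Matrix.mul_smul, Matrix.smul_mul, mul_one, ← Units.val_mul, mul_inv_cancel, Units.val_one]

/-- `HasRatEigenvalue` is conjugation-invariant (it only sees `tr` and `det`). -/
theorem hasRatEigenvalue_conj_iff (P : G q) (M : Mat q) :
    HasRatEigenvalue ((P : Mat q) * M * ((P⁻¹ : G q) : Mat q)) ↔ HasRatEigenvalue M := by
  simp only [HasRatEigenvalue, Matrix.det_units_conj, Matrix.trace_units_conj]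

/-- `P X P⁻¹ = 1 ↔ X = 1`. -/
theorem conj_eq_one_iff (P : G q) (X : Mat q) :
    (P : Mat q) * X * ((P⁻¹ : G q) : Mat q) = 1 ↔ X = 1 := by
  constructor
  · intro h
    calc X = ((P⁻¹ : G q) : Mat q) * ((P : Mat q) * X * ((P⁻¹ : G q) : Mat q)) * (P : Mat q) := by
          rw [← mul_assoc, ← mul_assoc, ← Units.val_mul, inv_mul_cancel, Units.val_one, one_mul, mul_assoc,
            ← Units.val_mul, inv_mul_cancel, Units.val_one, mul_one]
      _ = 1 := by rw [h, mul_one, ← Units.val_mul, inv_mul_cancel, Units.val_one]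
  · rintro rfl
    rw [mul_one, ← Units.val_mul, mul_inv_cancel, Units.val_one]

open scoped Classical in
/-- **`χ_W` is a class function** on matrices: `cubicNewvectorCharMat q (P M P⁻¹) = cubicNewvectorCharMat q M`. -/
theorem charMat_conj (P : G q) (M : Mat q) :
    cubicNewvectorCharMat q ((P : Mat q) * M * ((P⁻¹ : G q) : Mat q)) = cubicNewvectorCharMat q M := by
  simp only [cubicNewvectorCharMat, Matrix.det_units_conj, Matrix.trace_units_conj, isScalarMat_conj_iff,
    hasRatEigenvalue_conj_iff, Units.conj_pow, conj_eq_one_iff]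

/-- **`χ_W` is a class function** on `GL₂(𝔽_q)`. -/
theorem char_conj (h g : G q) : cubicNewvectorChar q (h * g * h⁻¹) = cubicNewvectorChar q g := by
  simp only [cubicNewvectorChar, Units.val_mul]
  exact charMat_conj h g

end ClassFunction

/-! ### Values of `χ_W` in the principal-series case -/

section Values
variable {q : ℕ} [Fact q.Prime]

/-- powers of a diagonal `2 × 2` matrix. -/
theorem diag_pow (a c : ZMod q) (k : ℕ) : (!![a, 0; 0, c] : Mat q) ^ k = !![a ^ k, 0; 0, c ^ k] := by
  have h : (!![a, 0; 0, c] : Mat q) = Matrix.diagonal ![a, c] := by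
    ext i j; fin_cases i <;> fin_cases j <;> simp
  have hk : (!![a ^ k, 0; 0, c ^ k] : Mat q) = Matrix.diagonal ![a ^ k, c ^ k] := by
    ext i j; fin_cases i <;> fin_cases j <;> simp
  rw [h, hk, Matrix.diagonal_pow]
  congr 1
  funext i; fin_cases i <;> simp

/-- `diag(a,c)`, `a ≠ c`, `q ≡ 1 (mod 3)`: `χ_W = 2` if `a^k = c^k` (`k = (q−1)/3`), else `−1`. -/
theorem charMat_diagonal (h1 : q % 3 = 1) {a c : ZMod q} (hac : a ≠ c) :
    cubicNewvectorCharMat q !![a, 0; 0, c] =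
      if a ^ ((q - 1) / 3) = c ^ ((q - 1) / 3) then 2 else -1 := by
  classical
  have hΔ : (!![a, 0; 0, c] : Mat q).trace ^ 2 - 4 * (!![a, 0; 0, c] : Mat q).det ≠ 0 := by
    rw [Matrix.trace_fin_two, Matrix.det_fin_two]
    simp only [Matrix.of_apply, Matrix.cons_val', Matrix.cons_val_zero, Matrix.cons_val_one,
      Matrix.cons_val_fin_one]
    have : (a + c) ^ 2 - 4 * (a * c - 0 * 0) = (a - c) ^ 2 := by ring
    rw [this]
    exact pow_ne_zero 2 (sub_ne_zero.2 hac)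
  have hrat : HasRatEigenvalue (!![a, 0; 0, c] : Mat q) := by
    refine ⟨a, ?_⟩
    rw [Matrix.trace_fin_two, Matrix.det_fin_two]
    simp
    ring
  have hpow : IsScalarMat ((!![a, 0; 0, c] : Mat q) ^ ((q - 1) / 3)) ↔ a ^ ((q - 1) / 3) = c ^ ((q - 1) / 3) := by
    rw [diag_pow]
    simp [IsScalarMat]
  simp only [cubicNewvectorCharMat, h1, if_true, hΔ, if_false, hrat, hpow]

/-- `(a y; 0 c) = u · diag(a,c) · u⁻¹` with `u = (1 z; 0 1)`, `z = y/(c − a)`, for `a ≠ c`. -/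
theorem upper_eq_conj_diagonal {a c : ZMod q} (hac : a ≠ c) (y : ZMod q) :
    ∃ P : G q, (!![a, y; 0, c] : Mat q) = (P : Mat q) * !![a, 0; 0, c] * ((P⁻¹ : G q) : Mat q) := by
  have hca : c - a ≠ 0 := sub_ne_zero.2 (Ne.symm hac)
  let z : ZMod q := y * (c - a)⁻¹
  let P : G q := ⟨!![1, z; 0, 1], !![1, -z; 0, 1],
    by ext i j; fin_cases i <;> fin_cases j <;> simp [Matrix.mul_apply],
    by ext i j; fin_cases i <;> fin_cases j <;> simp [Matrix.mul_apply]⟩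
  refine ⟨P, ?_⟩
  show (!![a, y; 0, c] : Mat q) = !![1, y * (c - a)⁻¹; 0, 1] * !![a, 0; 0, c] * !![1, -(y * (c - a)⁻¹); 0, 1]
  ext i j
  fin_cases i <;> fin_cases j <;> simp [Matrix.mul_apply, Fin.sum_univ_two]
  field_simp
  ring

/-- `χ_W((a y; 0 c)) = χ_W(diag(a,c))` for `a ≠ c`. -/
theorem charMat_upper {a c : ZMod q} (hac : a ≠ c) (y : ZMod q) :
    cubicNewvectorCharMat q !![a, y; 0, c] = cubicNewvectorCharMat q !![a, 0; 0, c] := by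
  obtain ⟨P, hP⟩ := upper_eq_conj_diagonal hac y
  rw [hP, charMat_conj]

/-- `χ_W((a y; 0 a)) = 1` for `y ≠ 0` (`q ≡ 1 (mod 3)`; non-scalar with vanishing discriminant). -/
theorem charMat_unipotent (h1 : q % 3 = 1) (a : ZMod q) {y : ZMod q} (hy : y ≠ 0) :
    cubicNewvectorCharMat q !![a, y; 0, a] = 1 := by
  have hΔ : (!![a, y; 0, a] : Mat q).trace ^ 2 - 4 * (!![a, y; 0, a] : Mat q).det = 0 := by
    rw [Matrix.trace_fin_two, Matrix.det_fin_two]; simp; ring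
  have hns : ¬ IsScalarMat (!![a, y; 0, a] : Mat q) := fun h => hy (by simpa using h.1)
  simp only [cubicNewvectorCharMat, h1, if_true, hΔ, hns, if_false]

/-- for odd `q`, a matrix without rational eigenvalue has non-zero discriminant (else `tr/2` is an eigenvalue). -/
theorem discr_ne_zero_of_not_hasRatEigenvalue (hq2 : q ≠ 2) {M : Mat q} (hM : ¬ HasRatEigenvalue M) :
    M.trace ^ 2 - 4 * M.det ≠ 0 := by
  intro hΔ
  apply hM
  have h2 : (2 : ZMod q) ≠ 0 := by
    intro h
    have := (ZMod.natCast_eq_zero_iff 2 q).1 (by exact_mod_cast h)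
    exact hq2 ((Nat.prime_dvd_prime_iff_eq (Fact.out : q.Prime) Nat.prime_two).1 this)
  set i2 : ZMod q := 2⁻¹ with hi2
  have h2i : 2 * i2 = 1 := mul_inv_cancel₀ h2
  refine ⟨M.trace * i2, ?_⟩
  linear_combination (-(i2 ^ 2)) * hΔ + (M.trace ^ 2 * i2 - M.det * (2 * i2 + 1)) * h2i

/-- `χ_W = 0` on elliptic elements (`q ≡ 1 (mod 3)`, `q` odd). -/
theorem charMat_elliptic (h1 : q % 3 = 1) {M : Mat q} (hM : ¬ HasRatEigenvalue M) :
    cubicNewvectorCharMat q M = 0 := by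
  have hq2 : q ≠ 2 := by rintro rfl; simp at h1
  have hΔ := discr_ne_zero_of_not_hasRatEigenvalue hq2 hM
  simp only [cubicNewvectorCharMat, h1, if_true, hΔ, if_false, hM]

end Values

/-! ### Character sums in the principal-series case -/

section Sums
variable {q : ℕ} [Fact q.Prime]

omit [Fact q.Prime] in
/-- `q − 1 = 3k` with `k = (q − 1)/3` when `q ≡ 1 (mod 3)`. -/
theorem three_mul_k (h1 : q % 3 = 1) : 3 * ((q - 1) / 3) = q - 1 := by
  have : 3 ∣ q - 1 := by omega
  exact Nat.mul_div_cancel' this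

/-- **`#{a ∈ 𝔽_q^× : a^k = 1} = k`** for `k = (q − 1)/3`, `q ≡ 1 (mod 3)` (the cubes form a subgroup of index `3`). -/
theorem card_cubeRoots (h1 : q % 3 = 1) :
    (Finset.univ.filter fun a : (ZMod q)ˣ => (a : ZMod q) ^ ((q - 1) / 3) = 1).card = (q - 1) / 3 := by
  classical
  have hq : q.Prime := Fact.out
  have hk0 : 0 < (q - 1) / 3 := by
    have := hq.two_le; omega
  have hk : (q - 1) / 3 ∣ Fintype.card (ZMod q) - 1 := by
    rw [ZMod.card]; exact ⟨3, by have := three_mul_k h1; omega⟩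
  have key := Literature.NumberTheory.QuadraticForms.Hermitian.card_pow_eq_one (K := ZMod q) hk0 hk
  -- compare the two finsets along the injection `(ZMod q)ˣ → ZMod q`
  have hAB : (Finset.univ.filter fun a : (ZMod q)ˣ => (a : ZMod q) ^ ((q - 1) / 3) = 1).card =
      (Finset.univ.filter fun x : ZMod q => x ^ ((q - 1) / 3) = 1).card := by
    refine Finset.card_bij (fun a _ => (a : ZMod q)) (fun a ha => ?_) (fun a _ b _ h => Units.ext h) (fun x hx => ?_)
    · simpa using ha
    · simp only [Finset.mem_filter, Finset.mem_univ, true_and] at hx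
      have hx0 : x ≠ 0 := by
        rintro rfl
        rw [zero_pow hk0.ne'] at hx
        exact zero_ne_one hx
      exact ⟨Units.mk0 x hx0, by simpa using hx, rfl⟩
  rw [hAB, key]

/-- the matrix of `diagGL u` in `!![…]` form. -/
theorem diagGL_coe' (u : Fin 2 → (ZMod q)ˣ) : ((diagGL u : G q) : Mat q) = !![(u 0 : ZMod q), 0; 0, (u 1 : ZMod q)] := by
  rw [diagGL_coe]
  ext i j
  fin_cases i <;> fin_cases j <;> simp

omit [Fact q.Prime] in
/-- the character at a scalar element in the principal-series case is `q + 1`. -/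
theorem char_of_isScalar_ps (h1 : q % 3 = 1) {z : G q} (hz : IsScalarMat (z : Mat q)) :
    cubicNewvectorChar q z = (q : ℤ) + 1 := by
  rw [cubicNewvectorChar, charMat_of_isScalar hz, if_pos h1]

/-- the character at `diag(a,1)`: `q + 1` at `a = 1`, else `2` or `−1` according as `a` is a cube or not. -/
theorem char_diagGL_mirabolic (h1 : q % 3 = 1) (a : (ZMod q)ˣ) :
    cubicNewvectorChar q (diagGL ![a, 1]) =
      if a = 1 then (q : ℤ) + 1 else if (a : ZMod q) ^ ((q - 1) / 3) = 1 then 2 else -1 := by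
  by_cases ha : a = 1
  · subst ha
    rw [if_pos rfl]
    exact char_of_isScalar_ps h1 (isScalarMat_diagGL_const 1)
  · rw [if_neg ha, cubicNewvectorChar, diagGL_coe']
    have ha' : ((![a, 1] : Fin 2 → (ZMod q)ˣ) 0 : ZMod q) ≠ ((![a, 1] : Fin 2 → (ZMod q)ˣ) 1 : ZMod q) := by
      simpa [Units.val_eq_one] using ha
    rw [charMat_diagonal h1 ha']
    simp

/-- **`Σ_{a ∈ 𝔽_q^×} χ_W(diag(a,1)) = q − 1`** (`q ≡ 1 (mod 3)`): `dim W^D = 1`. -/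
theorem sum_char_mirabolic (h1 : q % 3 = 1) :
    ∑ a : (ZMod q)ˣ, cubicNewvectorChar q (diagGL ![a, 1]) = (q : ℤ) - 1 := by
  classical
  have hq : q.Prime := Fact.out
  -- write χ(diag(a,1)) = (3·[a^k = 1] − 1) + (q − 1)·[a = 1]
  have hsplit : ∀ a : (ZMod q)ˣ, cubicNewvectorChar q (diagGL ![a, 1]) =
      (3 * (if (a : ZMod q) ^ ((q - 1) / 3) = 1 then 1 else 0) - 1) + (if a = 1 then (q : ℤ) - 1 else 0) := by
    intro a
    rw [char_diagGL_mirabolic h1 a]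
    by_cases ha : a = 1
    · subst ha; simp; ring
    · simp only [ha, if_false, add_zero]
      split_ifs <;> ring
  simp_rw [hsplit]
  rw [Finset.sum_add_distrib, Finset.sum_ite_eq' Finset.univ (1 : (ZMod q)ˣ), if_pos (Finset.mem_univ _),
    Finset.sum_sub_distrib, ← Finset.mul_sum, Finset.sum_boole, Finset.sum_const, Finset.card_univ,
    ZMod.card_units, card_cubeRoots h1]
  simp only [nsmul_eq_mul, mul_one]
  have h3k := three_mul_k h1
  have : (((q - 1) / 3 : ℕ) : ℤ) * 3 = ((q - 1 : ℕ) : ℤ) := by exact_mod_cast (by omega : (q - 1) / 3 * 3 = q - 1)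
  have hq1 : ((q - 1 : ℕ) : ℤ) = (q : ℤ) - 1 := by
    rw [Nat.cast_sub hq.one_le]; simp
  linear_combination this + 0 * hq1 - hq1 + hq1

/-- the character of `diag(u₀,u₁)` equals that of `diag(u₀/u₁, 1)` (both diagonal; only the ratio matters). -/
theorem char_diagGL_eq (h1 : q % 3 = 1) (u : Fin 2 → (ZMod q)ˣ) :
    cubicNewvectorChar q (diagGL u) = cubicNewvectorChar q (diagGL ![u 0 * (u 1)⁻¹, 1]) := by
  rw [char_diagGL_mirabolic h1]
  by_cases h : u 0 * (u 1)⁻¹ = 1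
  · rw [if_pos h]
    have hu : u 0 = u 1 := by rwa [mul_inv_eq_one] at h
    have hsc : IsScalarMat ((diagGL u : G q) : Mat q) := by
      have : u = ![u 1, u 1] := by funext i; fin_cases i <;> simp [hu]
      rw [this]; exact isScalarMat_diagGL_const (u 1)
    exact char_of_isScalar_ps h1 hsc
  · rw [if_neg h, cubicNewvectorChar, diagGL_coe']
    have hu : (u 0 : ZMod q) ≠ u 1 := by
      intro h'
      apply h
      rw [mul_inv_eq_one]
      exact Units.ext h'
    rw [charMat_diagonal h1 hu]
    have hk : ((u 0 * (u 1)⁻¹ : (ZMod q)ˣ) : ZMod q) ^ ((q - 1) / 3) = 1 ↔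
        (u 0 : ZMod q) ^ ((q - 1) / 3) = (u 1 : ZMod q) ^ ((q - 1) / 3) := by
      rw [Units.val_mul, Units.val_inv_eq_inv_val, mul_pow, inv_pow, mul_inv_eq_one₀]
      exact pow_ne_zero _ (u 1).ne_zero
    simp only [hk]

/-- **`Σ_{t ∈ T_s} χ_W(t) = (q − 1)²`** (`q ≡ 1 (mod 3)`): `dim W^{T_s} = 1`. -/
theorem sum_char_splitTorus (h1 : q % 3 = 1) :
    ∑ t ∈ splitTorus q, cubicNewvectorChar q t = ((q - 1 : ℕ) : ℤ) * ((q : ℤ) - 1) := by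
  rw [splitTorus_eq_image, Finset.sum_image (fun u _ v _ h => diagGL_injective h)]
  let e : (Fin 2 → (ZMod q)ˣ) ≃ (ZMod q)ˣ × (ZMod q)ˣ :=
    ⟨fun u => (u 0 * (u 1)⁻¹, u 1), fun p => ![p.1 * p.2, p.2],
      fun u => by funext i; fin_cases i <;> simp, fun p => by simp⟩
  calc ∑ u : Fin 2 → (ZMod q)ˣ, cubicNewvectorChar q (diagGL u)
      = ∑ u : Fin 2 → (ZMod q)ˣ, cubicNewvectorChar q (diagGL ![(e u).1, 1]) :=
        Finset.sum_congr rfl fun u _ => char_diagGL_eq h1 u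
    _ = ∑ p : (ZMod q)ˣ × (ZMod q)ˣ, cubicNewvectorChar q (diagGL ![p.1, 1]) :=
        Fintype.sum_equiv e _ (fun p => cubicNewvectorChar q (diagGL ![p.1, 1])) (fun _ => rfl)
    _ = ∑ a : (ZMod q)ˣ, ∑ _b : (ZMod q)ˣ, cubicNewvectorChar q (diagGL ![a, 1]) := Fintype.sum_prod_type _
    _ = ((q - 1 : ℕ) : ℤ) * ((q : ℤ) - 1) := by
        rw [← sum_char_mirabolic h1, Finset.mul_sum]
        refine Finset.sum_congr rfl fun a _ => ?_
        rw [Finset.sum_const, Finset.card_univ, ZMod.card_units, nsmul_eq_mul]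

/-- the character on the non-split torus: `q + 1` on scalars, `0` elsewhere (`q ≡ 1 (mod 3)`). -/
theorem char_linGL (h1 : q % 3 = 1) {η : Mat q} (hη : ¬ HasRatEigenvalue η) {p : ZMod q × ZMod q} (hp : p ≠ 0) :
    cubicNewvectorChar q (linGL η hη p) = if p.2 = 0 then (q : ℤ) + 1 else 0 := by
  rw [cubicNewvectorChar, linGL_coe hη hp]
  split_ifs with h2
  · have hsc : IsScalarMat (lin η p) := by
      refine ⟨?_, ?_, ?_⟩ <;> simp [lin, h2]
    rw [charMat_of_isScalar hsc, if_pos h1]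
  · exact charMat_elliptic h1 (not_hasRatEigenvalue_lin hη h2)

/-- **`Σ_{t ∈ T_C} χ_W(t) = (q − 1)(q + 1)`** (`q ≡ 1 (mod 3)`): `dim W^{T_C} = 1`. -/
theorem sum_char_nonsplitTorus (h1 : q % 3 = 1) {η : Mat q} (hη : ¬ HasRatEigenvalue η) :
    ∑ t ∈ nonsplitTorus η, cubicNewvectorChar q t = ((q - 1 : ℕ) : ℤ) * ((q : ℤ) + 1) := by
  classical
  rw [nonsplitTorus_eq_image hη, Finset.sum_image]
  swap
  · intro p hp p' hp' h
    have hp0 : p ≠ 0 := by simpa using hp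
    have hp0' : p' ≠ 0 := by simpa using hp'
    have := congrArg (fun g : G q => (g : Mat q)) h
    simp only [linGL_coe hη hp0, linGL_coe hη hp0'] at this
    exact lin_injective hη this
  have : ∀ p ∈ (Finset.univ : Finset (ZMod q × ZMod q)).erase 0,
      cubicNewvectorChar q (linGL η hη p) = if p.2 = 0 then (q : ℤ) + 1 else 0 := by
    intro p hp
    exact char_linGL h1 hη (Finset.ne_of_mem_erase hp)
  rw [Finset.sum_congr rfl this, Finset.sum_ite, Finset.sum_const_zero, add_zero, Finset.sum_const, nsmul_eq_mul]
  congr 1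
  -- `#{p ≠ 0 : p.2 = 0} = q − 1`
  have hset : ((Finset.univ : Finset (ZMod q × ZMod q)).erase 0).filter (fun p => p.2 = 0) =
      ((Finset.univ : Finset (ZMod q)).erase 0).image (fun a => (a, (0 : ZMod q))) := by
    ext p
    simp only [Finset.mem_filter, Finset.mem_erase, Finset.mem_univ, and_true, Finset.mem_image]
    constructor
    · rintro ⟨hp, h2⟩
      refine ⟨p.1, ?_, Prod.ext rfl h2.symm⟩
      rintro h1'
      exact hp (Prod.ext h1' h2)
    · rintro ⟨a, ha, rfl⟩
      exact ⟨fun h => ha (congrArg Prod.fst h), rfl⟩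
  rw [hset, Finset.card_image_of_injective _ (fun a b h => congrArg Prod.fst h),
    Finset.card_erase_of_mem (Finset.mem_univ _), Finset.card_univ, ZMod.card]

variable (𝓛 : CartanTorusLattice q)

/-- **`w_S ≠ 0`** in the principal-series case: `N_{T_s}` has trace `(q − 1)² ≠ 0` and lands in `ℤ·w_S`. -/
theorem wS_ne_zero (h1 : q % 3 = 1) {wS : Fin 𝓛.d → ℤ}
    (hSgen : ∀ v, 𝓛.IsSplitFixed v → ∃ m : ℤ, v = m • wS) : wS ≠ 0 := by
  have hq : q.Prime := Fact.out
  refine ne_zero_of_normOp_along 𝓛 (S := splitTorus q) (fun x => hSgen _ (isSplitFixed_normOp 𝓛 x)) ?_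
  rw [sum_char_splitTorus h1]
  have h5 : 2 ≤ q := hq.two_le
  have : ((q - 1 : ℕ) : ℤ) ≠ 0 := by exact_mod_cast (by omega : q - 1 ≠ 0)
  exact mul_ne_zero this (by omega)

/-- **`w_C ≠ 0`** in the principal-series case: `N_{T_C}` has trace `(q − 1)(q + 1) ≠ 0` and lands in `ℤ·w_C`. -/
theorem wC_ne_zero (h1 : q % 3 = 1) {wC : Fin 𝓛.d → ℤ}
    (hCgen : ∀ v, 𝓛.IsNonsplitFixed v → ∃ m : ℤ, v = m • wC) : wC ≠ 0 := by
  have hq : q.Prime := Fact.out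
  refine ne_zero_of_normOp_along 𝓛 (S := nonsplitTorus 𝓛.η)
    (fun x => hCgen _ (isNonsplitFixed_normOp 𝓛 x)) ?_
  rw [sum_char_nonsplitTorus h1 𝓛.η_irred]
  have h5 : 2 ≤ q := hq.two_le
  have : ((q - 1 : ℕ) : ℤ) ≠ 0 := by exact_mod_cast (by omega : q - 1 ≠ 0)
  exact mul_ne_zero this (by omega)

end Sums

end Summit.BirchSwinnertonDyer.BirchSwinnertonDyer.Theorems.CartanTorusCubeCut.PS
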